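import Literature.NumberTheory.Rogawski1990.ArchBouazizTwoChartLeaves                 -- ★ p851404 (this seat): (JH-A) `exists_twoChart_placeLeaves_stOrbFamH_model`, `stOrbFamH_eq_model_of_regS_identity`; brings ★ p850992, ★ (T-CONGR)
import Literature.NumberTheory.Automorphic.ArchEndoscopicChartOrbUnfoldLeavesGivenPos    -- ★ (this seat): `exists_pos_archRH_mul_chartOrbH_eq_of_placeLeaves_of_isHaarMeasure` (`0 < K₀`), `exists_smul_map_descConj_quotientMeasure_of_eq` via ★ p851388
import HarnessLib

/-!
# (JH-A-pos) TWO-CHART LEAVES WITH POSITIVE CONSTANTS `K₀, K₀′ > 0` — ★ (JH-A) `exists_twoChart_placeLeaves_stOrbFamH_model` verbatim plus `0 < K₀ ∧ 0 < K₀′` first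
# (L3′ forward half (J)-H: the jump constant `jcH S w₀ ≠ 0`; Varadarajan 1989 §6.4, Shelstad 1979 §4, Bouaziz 1994 §3.1, Folland 1995 §2.6)

Topic `NumberTheory/Rogawski1990`; namespace `Literature.NumberTheory.Rogawski1990`.  THEOREMS ONLY (no `def`, no instance, no axiom, no `sorry`).  Cell `pub/hodgecm-mathlib`,
crux H413 (`stmt-HodgeConjecture-24833`), line LH3 (closer stub `stub_N9`, DIRECT ROAD), organ L3′ forward half (J)-H, brick **(JH-A-pos)** (ask of the final payer
LH3-p03 (g6) 12:24:03Z: ★ (JH-asm) `exists_jumpConst_stOrbFamH_of_twoChartDescent` takes `hK₁ : K₁ ≠ 0`, `hK₂ : K₂ ≠ 0` with `K₁ := I·K₀`, `K₂ := K₀′·Ch`, so the two-chart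
package must say `K₀, K₀′ ≠ 0`; ★ (JH-A) forgot to).  Author LH10-p02 (g7).  Count-neutral.

WHAT.  **`exists_twoChart_placeLeaves_stOrbFamH_model_pos (hw₀ : w₀ ∉ S) : ∃ νw hνH hνR K₀ K₀′ Λw Λw′ Zw Zw′ C′, 0 < K₀ ∧ 0 < K₀′ ∧ ‹★ (JH-A)'s body verbatim›`** — the same
construction as ★ (JH-A) (the `S`-leaves of ★ `exists_placeLeaf_explicit` at every place, the split leaf at `w₀` of the chart `insert w₀ S`, the leaf identities off `w₀` transported
by ★ `exists_smul_map_descConj_quotientMeasure_of_eq`), run through the POSITIVE assembly ★ `exists_pos_archRH_mul_chartOrbH_eq_of_placeLeaves_of_isHaarMeasure` with the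
leaf scalars `C_w ≠ 0` (★ `exists_placeLeaf_explicit`) and `κ_w · C_w ≠ 0`.
HONEST LABEL: HC_CM is proved only modulo the 7 printed citations (2 remaining: hLiu418 = stmt-HodgeConjecture-24832, h413 = stmt-HodgeConjecture-24833) until rung 0 closes;
measure-theoretic bookkeeping for the (J)-H jump, pays nothing by itself.

## References
* [Varadarajan1989] V. S. Varadarajan, *An Introduction to Harmonic Analysis on Semisimple Lie Groups* (1989), §6.4 Lemma 21, Thm 23.
* [Shelstad1979] D. Shelstad, *Characters and inner forms of a quasi-split group over ℝ*, Compositio Math. 39 (1979), §4 pp. 22–25.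
* [Bouaziz1994IntegralesOrbitales] A. Bouaziz, *Intégrales orbitales sur les algèbres de Lie réductives*, Invent. Math. 115 (1994), §3.1 p. 579; §6.2 p. 591.
* [Folland1995] G. B. Folland, *A Course in Abstract Harmonic Analysis* (1995), §2.6 (2.52); [DeitmarEchterhoff2014] Thm. 1.5.3; [Rogawski1990] §4.1 (4.1.1) p. 39, §8.2 pp. 119–122.
-/

set_option autoImplicit false

noncomputable section

open MeasureTheory Measure Filter Topology Set Function NumberField NumberField.InfinitePlace Matrix Complex
open Literature.NumberTheory.Automorphic Literature.NumberTheory.Automorphic.UnitaryGroup Literature.NumberTheory.Automorphic.ArchCartan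
open Literature.MeasureTheory.Group
open scoped ContDiff Classical MatrixGroups Matrix ENNReal NNReal

namespace Literature.NumberTheory.Rogawski1990

local notation3 "Φ₂[" L "]" => (Matrix.of fun i j : Fin 2 => if i.val + j.val + 1 = 2 then (1 : L) else 0)
local notation3 "Φ₁[" L "]" => (Matrix.of fun i j : Fin 1 => if i.val + j.val + 1 = 1 then (1 : L) else 0)
local notation3 "𝔸[" L "]" => ↥(arch (↥(maximalRealSubfield L)) L (IsCMField.complexConj L) 2 Φ₂[L])
local notation3 "𝔹[" L "]" => ↥(arch (↥(maximalRealSubfield L)) L (IsCMField.complexConj L) 1 Φ₁[L])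

section TwoChartsPos
variable (L : Type) [Field L] [NumberField L] [IsCMField L] (S : Finset {w : InfinitePlace L // IsComplex w}) (w₀ : {w : InfinitePlace L // IsComplex w})
  [∀ w : {w : InfinitePlace L // IsComplex w}, MeasurableSpace ↥(archLocal L 2 Φ₂[L] w)]
  [∀ w : {w : InfinitePlace L // IsComplex w}, BorelSpace ↥(archLocal L 2 Φ₂[L] w)]
  [MeasurableSpace 𝔸[L]] [BorelSpace 𝔸[L]] [MeasurableSpace 𝔹[L]] [BorelSpace 𝔹[L]]
  (νH : Measure (𝔸[L] × 𝔹[L])) [νH.IsHaarMeasure] [νH.IsMulRightInvariant]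

set_option maxHeartbeats 800000 in
/-- **(JH-A-pos) TWO-CHART LEAVES WITH POSITIVE CONSTANTS.**  ★ `exists_twoChart_placeLeaves_stOrbFamH_model` VERBATIM with the two extra conjuncts `0 < K₀ ∧ 0 < K₀′`
FIRST (the constants are the positive assembly constants of ★ `exists_pos_archRH_mul_chartOrbH_eq_of_placeLeaves_of_isHaarMeasure`; the leaf scalars are `C_w ≠ 0` from ★
`exists_placeLeaf_explicit` and `κ_w · C_w ≠ 0` after transport) — what makes the (J)-H jump constant `jcH S w₀ = (I K₀ ∕ (K₀′ Ch)) · 2κ₀` NON-ZERO.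
[cite: Varadarajan1989, §6.4 Lemma 21, Thm 23] [cite: Shelstad1979, §4 pp. 22–25] [cite: Bouaziz1994IntegralesOrbitales, §3.1 p. 579; §6.2 p. 591] [cite: Folland1995, §2.6 (2.52)]
[cite: DeitmarEchterhoff2014, Thm. 1.5.3] [cite: Rogawski1990, §4.1 (4.1.1) p. 39; §8.2 pp. 119–122] -/
theorem exists_twoChart_placeLeaves_stOrbFamH_model_pos (hw₀ : w₀ ∉ S) :
    ∃ (νw : ∀ w : {w : InfinitePlace L // IsComplex w}, Measure ↥(archLocal L 2 Φ₂[L] w)) (hνH : ∀ w, (νw w).IsHaarMeasure) (hνR : ∀ w, (νw w).IsMulRightInvariant)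
      (K₀ K₀' : ℝ)
      (Λw Λw' : ∀ w : {w : InfinitePlace L // IsComplex w}, Measure (↥(archLocal L 2 Φ₂[L] w) × ↥(archLocal L 2 Φ₂[L] w)))
      (Zw Zw' : ∀ w : {w : InfinitePlace L // IsComplex w}, Set (↥(archLocal L 2 Φ₂[L] w) × ↥(archLocal L 2 Φ₂[L] w))) (C' : ℝ≥0),
      -- ══ POSITIVE CONSTANTS
      0 < K₀ ∧ 0 < K₀' ∧
      -- ══ SHARED LEAVES OFF `w₀`
      (∀ w, w ≠ w₀ → Λw' w = Λw w) ∧ (∀ w, w ≠ w₀ → Zw' w = Zw w) ∧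
      -- ══ CHART `S` (compact at `w₀`): the measure-theoretic clauses of ★ (α1) for `(Λw, Zw)`
      ((∀ w, IsFiniteMeasureOnCompacts (Λw w)) ∧ (∀ w, SigmaFinite (Λw w)) ∧ (∀ w, IsClosed (Zw w)) ∧ (∀ w, Λw w (Zw w)ᶜ = 0) ∧
      (∀ w, w ∉ S → Λw w = Measure.map (fun g : ↥(archLocal L 2 Φ₂[L] w) => (g, (1 : ↥(archLocal L 2 Φ₂[L] w)))) (νw w)) ∧
      (∀ (w) (U : Set ({w : InfinitePlace L // IsComplex w} → Fin 3 → ℝ)), IsCompact U → (w ∉ S → ∀ c ∈ U, Circle.exp (c w 0) ≠ Circle.exp (c w 2)) →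
        ∀ C'' : Set ↥(archLocal L 2 Φ₂[L] w), IsCompact C'' →
          ∃ 𝒮 : Set (↥(archLocal L 2 Φ₂[L] w) × ↥(archLocal L 2 Φ₂[L] w)), IsCompact 𝒮 ∧
            ∀ z ∈ Zw w, ∀ c ∈ U, z.1 * (endoBlockAt L S w (c w) * z.2) * z.1⁻¹ ∈ C'' → z ∈ 𝒮)) ∧
      -- ══ CHART `insert w₀ S` (split at `w₀`): the same for `(Λw', Zw')`
      ((∀ w, IsFiniteMeasureOnCompacts (Λw' w)) ∧ (∀ w, SigmaFinite (Λw' w)) ∧ (∀ w, IsClosed (Zw' w)) ∧ (∀ w, Λw' w (Zw' w)ᶜ = 0) ∧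
      (∀ w, w ∉ insert w₀ S → Λw' w = Measure.map (fun g : ↥(archLocal L 2 Φ₂[L] w) => (g, (1 : ↥(archLocal L 2 Φ₂[L] w)))) (νw w)) ∧
      (∀ (w) (U : Set ({w : InfinitePlace L // IsComplex w} → Fin 3 → ℝ)), IsCompact U → (w ∉ insert w₀ S → ∀ c ∈ U, Circle.exp (c w 0) ≠ Circle.exp (c w 2)) →
        ∀ C'' : Set ↥(archLocal L 2 Φ₂[L] w), IsCompact C'' →
          ∃ 𝒮 : Set (↥(archLocal L 2 Φ₂[L] w) × ↥(archLocal L 2 Φ₂[L] w)), IsCompact 𝒮 ∧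
            ∀ z ∈ Zw' w, ∀ c ∈ U, z.1 * (endoBlockAt L (insert w₀ S) w (c w) * z.2) * z.1⁻¹ ∈ C'' → z ∈ 𝒮)) ∧
      -- ══ THE QUOTIENT IDENTITY OF THE SPLIT LEAF `Λw' w₀` (★ `exists_placeLeaf`'s clause at the split place `w₀ ∈ insert w₀ S`)
      C' ≠ 0 ∧
      (∀ c : {w : InfinitePlace L // IsComplex w} → Fin 3 → ℝ, c w₀ 0 ≠ 0 →
        (haveI := locallyCompactSpace_archLocal_two L w₀
         haveI := secondCountableTopology_archLocal_two L w₀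
         haveI : (νw w₀).IsHaarMeasure := hνH w₀
         haveI : (νw w₀).IsMulRightInvariant := hνR w₀
         haveI := isHaarMeasure_chartHaarHLoc L (insert w₀ S) w₀
         haveI := isInvInvariant_chartHaarHLoc L (insert w₀ S) w₀
         letI : MeasurableSpace (↥(archLocal L 2 Φ₂[L] w₀) ⧸ chartTorusHLoc L (insert w₀ S) w₀) := borel _
         haveI : BorelSpace (↥(archLocal L 2 Φ₂[L] w₀) ⧸ chartTorusHLoc L (insert w₀ S) w₀) := ⟨rfl⟩
         Measure.map (descConj (endoBlockAt L (insert w₀ S) w₀ (c w₀)) (chartTorusHLoc L (insert w₀ S) w₀)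
             (forall_mem_chartTorusHLoc_comm L (insert w₀ S) w₀ (c w₀)) id)
           (quotientMeasure (chartTorusHLoc L (insert w₀ S) w₀) (chartHaarHLoc L (insert w₀ S) w₀) (isClosed_chartTorusHLoc L (insert w₀ S) w₀) (νw w₀))) =
          (C' * ‖(((Real.exp (-2 * c w₀ 0) : ℝ) : ℂ)) - 1‖₊⁻¹) •
            Measure.map (fun z : ↥(archLocal L 2 Φ₂[L] w₀) × ↥(archLocal L 2 Φ₂[L] w₀) => z.1 * (endoBlockAt L (insert w₀ S) w₀ (c w₀) * z.2) * z.1⁻¹) (Λw' w₀)) ∧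
      -- ══ FOR EVERY TEST FUNCTION: (a)(b)(c)(d) of ★ p850992, chart `S` with `(K₀, Λw)` and chart `insert w₀ S` with `(K₀', Λw')`
      ∀ {fH : 𝔸[L] × 𝔹[L] → ℂ}, ArchSmooth₂ L fH →
        ((∀ c : {w : InfinitePlace L // IsComplex w} → Fin 3 → ℝ, c ∈ RegS S →
          archRH S c * chartOrbH L νH S fH c =
            (K₀ : ℂ) * (∏ w, (if w ∈ S then ((Real.exp (c w 0) : ℝ) : ℂ) else 1 - (Circle.exp (c w 2 - c w 0) : ℂ))) *
              ∫ z, fH ((archPiEquivCM 2 L Φ₂[L]).symm (fun w => (z w).1 * (endoBlockAt L S w (c w) * (z w).2) * (z w).1⁻¹), (endoTorus L S c).2) ∂(Measure.pi Λw)) ∧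
        ContDiffOn ℝ ∞ (fun c : {w : InfinitePlace L // IsComplex w} → Fin 3 → ℝ =>
          ∫ z, fH ((archPiEquivCM 2 L Φ₂[L]).symm (fun w => (z w).1 * (endoBlockAt L S w (c w) * (z w).2) * (z w).1⁻¹), (endoTorus L S c).2) ∂(Measure.pi Λw))
          (InRegS S) ∧
        (∀ c : {w : InfinitePlace L // IsComplex w} → Fin 3 → ℝ, c ∈ InRegS S →
          stOrbFamH L νH fH S c =
            (K₀ : ℂ) * (∏ w, (if w ∈ S then ((Real.exp (c w 0) : ℝ) : ℂ) else 1 - (Circle.exp (c w 2 - c w 0) : ℂ))) *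
              ∑ T ∈ (Finset.univ \ S).powerset, ∫ z, fH ((archPiEquivCM 2 L Φ₂[L]).symm
                (fun w => (z w).1 * (endoBlockAt L S w (flipSet T c w) * (z w).2) * (z w).1⁻¹), (endoTorus L S (flipSet T c)).2) ∂(Measure.pi Λw)) ∧
        (∀ (p : {w : InfinitePlace L // IsComplex w} → Prop) [DecidablePred p], (∀ w, p w → w ∉ S) →
          ∀ c : {w : InfinitePlace L // IsComplex w} → Fin 3 → ℝ, c ∈ InRegS S →
            (∫ z, fH ((archPiEquivCM 2 L Φ₂[L]).symm (fun w => (z w).1 * (endoBlockAt L S w (c w) * (z w).2) * (z w).1⁻¹), (endoTorus L S c).2)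
                ∂(Measure.pi Λw)) =
              ∫ z' : ∀ w : {w : {w : InfinitePlace L // IsComplex w} // ¬ p w}, ↥(archLocal L 2 Φ₂[L] w.1) × ↥(archLocal L 2 Φ₂[L] w.1),
                (∫ g : ∀ w : {w : {w : InfinitePlace L // IsComplex w} // p w}, ↥(archLocal L 2 Φ₂[L] w.1),
                  fH ((archPiEquivCM 2 L Φ₂[L]).symm (fun w => if h : p w then g ⟨w, h⟩ * endoBlockAt L S w (c w) * (g ⟨w, h⟩)⁻¹
                    else (z' ⟨w, h⟩).1 * (endoBlockAt L S w (c w) * (z' ⟨w, h⟩).2) * (z' ⟨w, h⟩).1⁻¹), (endoTorus L S c).2)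
                  ∂(Measure.pi fun w : {w : {w : InfinitePlace L // IsComplex w} // p w} => νw w.1))
                ∂(Measure.pi fun w : {w : {w : InfinitePlace L // IsComplex w} // ¬ p w} => Λw w.1))) ∧
        ((∀ c : {w : InfinitePlace L // IsComplex w} → Fin 3 → ℝ, c ∈ RegS (insert w₀ S) →
          archRH (insert w₀ S) c * chartOrbH L νH (insert w₀ S) fH c =
            (K₀' : ℂ) * (∏ w, (if w ∈ insert w₀ S then ((Real.exp (c w 0) : ℝ) : ℂ) else 1 - (Circle.exp (c w 2 - c w 0) : ℂ))) *
              ∫ z, fH ((archPiEquivCM 2 L Φ₂[L]).symm (fun w => (z w).1 * (endoBlockAt L (insert w₀ S) w (c w) * (z w).2) * (z w).1⁻¹), (endoTorus L (insert w₀ S) c).2) ∂(Measure.pi Λw')) ∧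
        ContDiffOn ℝ ∞ (fun c : {w : InfinitePlace L // IsComplex w} → Fin 3 → ℝ =>
          ∫ z, fH ((archPiEquivCM 2 L Φ₂[L]).symm (fun w => (z w).1 * (endoBlockAt L (insert w₀ S) w (c w) * (z w).2) * (z w).1⁻¹), (endoTorus L (insert w₀ S) c).2) ∂(Measure.pi Λw'))
          (InRegS (insert w₀ S)) ∧
        (∀ c : {w : InfinitePlace L // IsComplex w} → Fin 3 → ℝ, c ∈ InRegS (insert w₀ S) →
          stOrbFamH L νH fH (insert w₀ S) c =
            (K₀' : ℂ) * (∏ w, (if w ∈ insert w₀ S then ((Real.exp (c w 0) : ℝ) : ℂ) else 1 - (Circle.exp (c w 2 - c w 0) : ℂ))) *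
              ∑ T ∈ (Finset.univ \ insert w₀ S).powerset, ∫ z, fH ((archPiEquivCM 2 L Φ₂[L]).symm
                (fun w => (z w).1 * (endoBlockAt L (insert w₀ S) w (flipSet T c w) * (z w).2) * (z w).1⁻¹), (endoTorus L (insert w₀ S) (flipSet T c)).2) ∂(Measure.pi Λw')) ∧
        (∀ (p : {w : InfinitePlace L // IsComplex w} → Prop) [DecidablePred p], (∀ w, p w → w ∉ insert w₀ S) →
          ∀ c : {w : InfinitePlace L // IsComplex w} → Fin 3 → ℝ, c ∈ InRegS (insert w₀ S) →
            (∫ z, fH ((archPiEquivCM 2 L Φ₂[L]).symm (fun w => (z w).1 * (endoBlockAt L (insert w₀ S) w (c w) * (z w).2) * (z w).1⁻¹), (endoTorus L (insert w₀ S) c).2)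
                ∂(Measure.pi Λw')) =
              ∫ z' : ∀ w : {w : {w : InfinitePlace L // IsComplex w} // ¬ p w}, ↥(archLocal L 2 Φ₂[L] w.1) × ↥(archLocal L 2 Φ₂[L] w.1),
                (∫ g : ∀ w : {w : {w : InfinitePlace L // IsComplex w} // p w}, ↥(archLocal L 2 Φ₂[L] w.1),
                  fH ((archPiEquivCM 2 L Φ₂[L]).symm (fun w => if h : p w then g ⟨w, h⟩ * endoBlockAt L (insert w₀ S) w (c w) * (g ⟨w, h⟩)⁻¹
                    else (z' ⟨w, h⟩).1 * (endoBlockAt L (insert w₀ S) w (c w) * (z' ⟨w, h⟩).2) * (z' ⟨w, h⟩).1⁻¹), (endoTorus L (insert w₀ S) c).2)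
                  ∂(Measure.pi fun w : {w : {w : InfinitePlace L // IsComplex w} // p w} => νw w.1))
                ∂(Measure.pi fun w : {w : {w : InfinitePlace L // IsComplex w} // ¬ p w} => Λw' w.1))) := by
  haveI : ∀ w : {w : InfinitePlace L // IsComplex w}, LocallyCompactSpace ↥(archLocal L 2 Φ₂[L] w) := fun w => locallyCompactSpace_archLocal_two L w
  haveI : ∀ w : {w : InfinitePlace L // IsComplex w}, SecondCountableTopology ↥(archLocal L 2 Φ₂[L] w) := fun w => secondCountableTopology_archLocal_two L w
  -- Haar measures at the places (right invariant: the `U(Φ₂)_w` are unimodular)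
  obtain ⟨νw, hνw⟩ : ∃ νw : ∀ w : {w : InfinitePlace L // IsComplex w}, Measure ↥(archLocal L 2 Φ₂[L] w), ∀ w, (νw w).IsHaarMeasure :=
    ⟨fun w => Measure.haar, fun w => inferInstance⟩
  haveI : ∀ w, (νw w).IsHaarMeasure := hνw
  have hνr : ∀ w : {w : InfinitePlace L // IsComplex w}, (νw w).IsMulRightInvariant := fun w => by
    haveI : LocallyCompactSpace ↥(unitaryGroupOfForm (starRingEnd ℂ) ((Φ₂[L]).map w.1.embedding)) := locallyCompactSpace_archLocal_two L w
    have h1 : ∀ g : ↥(archLocal L 2 Φ₂[L] w), modularCharacterFun g = 1 := fun g =>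
      modularCharacterFun_eq_one_of_eq_over_antidiagonal_two (map_embedding_antidiagTwo_eq_over L w) g
    exact isMulRightInvariant_of_modularCharacterFun_eq_one (G := ↥(archLocal L 2 Φ₂[L] w)) h1 (νw w)
  haveI := hνr
  -- Borel structures on the quotients and the torus Haar measures, for BOTH charts
  letI : ∀ w : {w : InfinitePlace L // IsComplex w}, MeasurableSpace (↥(archLocal L 2 Φ₂[L] w) ⧸ chartTorusHLoc L S w) := fun w => borel _
  haveI : ∀ w : {w : InfinitePlace L // IsComplex w}, BorelSpace (↥(archLocal L 2 Φ₂[L] w) ⧸ chartTorusHLoc L S w) := fun w => ⟨rfl⟩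
  letI : ∀ w : {w : InfinitePlace L // IsComplex w}, MeasurableSpace (↥(archLocal L 2 Φ₂[L] w) ⧸ chartTorusHLoc L (insert w₀ S) w) := fun w => borel _
  haveI : ∀ w : {w : InfinitePlace L // IsComplex w}, BorelSpace (↥(archLocal L 2 Φ₂[L] w) ⧸ chartTorusHLoc L (insert w₀ S) w) := fun w => ⟨rfl⟩
  haveI : ∀ w, (chartHaarHLoc L S w).IsHaarMeasure := fun w => isHaarMeasure_chartHaarHLoc L S w
  haveI : ∀ w, (chartHaarHLoc L S w).IsInvInvariant := fun w => isInvInvariant_chartHaarHLoc L S w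
  haveI : ∀ w, (chartHaarHLoc L (insert w₀ S) w).IsHaarMeasure := fun w => isHaarMeasure_chartHaarHLoc L (insert w₀ S) w
  haveI : ∀ w, (chartHaarHLoc L (insert w₀ S) w).IsInvInvariant := fun w => isInvInvariant_chartHaarHLoc L (insert w₀ S) w
  -- membership bookkeeping
  have hmem : ∀ w : {w : InfinitePlace L // IsComplex w}, w ≠ w₀ → (w ∈ S ↔ w ∈ insert w₀ S) := fun w hw => by
    rw [Finset.mem_insert, or_iff_right hw]
  have hw₀' : w₀ ∈ insert w₀ S := Finset.mem_insert_self w₀ S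
  -- (1) the per-place leaves of the chart `S` (compact leaves explicit), and the split leaf at `w₀` of the chart `insert w₀ S`
  choose Λw Zw Cw hΛfin hZcl hZnull hCne hprop hexpl hleaf using fun w : {w : InfinitePlace L // IsComplex w} => exists_placeLeaf_explicit L S w (νw w)
  haveI : ∀ w, IsFiniteMeasureOnCompacts (Λw w) := hΛfin
  obtain ⟨Λ₀, Z₀, C₀, hΛ₀fin, hZ₀cl, hZ₀null, hC₀ne, hprop₀, -, hleaf₀⟩ := exists_placeLeaf_explicit L (insert w₀ S) w₀ (νw w₀)
  haveI := hΛ₀fin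
  -- (2) the second family: the `S`-leaves off `w₀`, the split leaf at `w₀`
  let Λw' : ∀ w : {w : InfinitePlace L // IsComplex w}, Measure (↥(archLocal L 2 Φ₂[L] w) × ↥(archLocal L 2 Φ₂[L] w)) := Function.update Λw w₀ Λ₀
  let Zw' : ∀ w : {w : InfinitePlace L // IsComplex w}, Set (↥(archLocal L 2 Φ₂[L] w) × ↥(archLocal L 2 Φ₂[L] w)) := Function.update Zw w₀ Z₀
  have hΛ'₀ : Λw' w₀ = Λ₀ := Function.update_self w₀ Λ₀ Λw
  have hZ'₀ : Zw' w₀ = Z₀ := Function.update_self w₀ Z₀ Zw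
  have hΛ'ne : ∀ w, w ≠ w₀ → Λw' w = Λw w := fun w hw => Function.update_of_ne hw Λ₀ Λw
  have hZ'ne : ∀ w, w ≠ w₀ → Zw' w = Zw w := fun w hw => Function.update_of_ne hw Z₀ Zw
  have hΛ'fin : ∀ w, IsFiniteMeasureOnCompacts (Λw' w) := by
    intro w
    by_cases hw : w = w₀
    · subst hw; rw [hΛ'₀]; exact hΛ₀fin
    · rw [hΛ'ne w hw]; exact hΛfin w
  haveI := hΛ'fin
  have hσ : ∀ w, SigmaFinite (Λw w) := fun w => inferInstance
  have hσ' : ∀ w, SigmaFinite (Λw' w) := fun w => inferInstance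
  have hZcl' : ∀ w, IsClosed (Zw' w) := by
    intro w
    by_cases hw : w = w₀
    · subst hw; rw [hZ'₀]; exact hZ₀cl
    · rw [hZ'ne w hw]; exact hZcl w
  have hZnull' : ∀ w, Λw' w (Zw' w)ᶜ = 0 := by
    intro w
    by_cases hw : w = w₀
    · subst hw; rw [hΛ'₀, hZ'₀]; exact hZ₀null
    · rw [hΛ'ne w hw, hZ'ne w hw]; exact hZnull w
  have hexpl' : ∀ w, w ∉ insert w₀ S → Λw' w = Measure.map (fun g : ↥(archLocal L 2 Φ₂[L] w) => (g, (1 : ↥(archLocal L 2 Φ₂[L] w)))) (νw w) := by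
    intro w hw
    rw [Finset.mem_insert, not_or] at hw
    rw [hΛ'ne w hw.1]
    exact hexpl w hw.2
  have hprop' : ∀ (w) (U : Set ({w : InfinitePlace L // IsComplex w} → Fin 3 → ℝ)), IsCompact U →
      (w ∉ insert w₀ S → ∀ c ∈ U, Circle.exp (c w 0) ≠ Circle.exp (c w 2)) →
      ∀ C'' : Set ↥(archLocal L 2 Φ₂[L] w), IsCompact C'' →
        ∃ 𝒮 : Set (↥(archLocal L 2 Φ₂[L] w) × ↥(archLocal L 2 Φ₂[L] w)), IsCompact 𝒮 ∧
          ∀ z ∈ Zw' w, ∀ c ∈ U, z.1 * (endoBlockAt L (insert w₀ S) w (c w) * z.2) * z.1⁻¹ ∈ C'' → z ∈ 𝒮 := by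
    intro w U hU hreg C'' hC''
    by_cases hw : w = w₀
    · subst hw; rw [hZ'₀]; exact hprop₀ U hU hreg C'' hC''
    · rw [hZ'ne w hw, ← endoBlockAt_eq_of_mem_iff L w (hmem w hw)]
      exact hprop w U hU (fun hwS => hreg fun h => hwS ((hmem w hw).2 h)) C'' hC''
  -- properness at the single points of `RegS` (the input form of the assembly)
  have hprop1 : ∀ (w) (c : {w : InfinitePlace L // IsComplex w} → Fin 3 → ℝ), c ∈ RegS S → ∀ C' : Set ↥(archLocal L 2 Φ₂[L] w), IsCompact C' →
      ∃ 𝒮 : Set (↥(archLocal L 2 Φ₂[L] w) × ↥(archLocal L 2 Φ₂[L] w)), IsCompact 𝒮 ∧ ∀ z ∈ Zw w, z.1 * (endoBlockAt L S w (c w) * z.2) * z.1⁻¹ ∈ C' → z ∈ 𝒮 := by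
    intro w c hc C' hC'
    obtain ⟨𝒮, h𝒮, h⟩ := hprop w {c} isCompact_singleton (fun hw c' hc' => by
      rw [Set.mem_singleton_iff.1 hc']; exact ((mem_regS_iff S c).1 hc).1 w hw) C' hC'
    exact ⟨𝒮, h𝒮, fun z hz hzC => h z hz c (Set.mem_singleton c) hzC⟩
  have hprop1' : ∀ (w) (c : {w : InfinitePlace L // IsComplex w} → Fin 3 → ℝ), c ∈ RegS (insert w₀ S) → ∀ C' : Set ↥(archLocal L 2 Φ₂[L] w), IsCompact C' →
      ∃ 𝒮 : Set (↥(archLocal L 2 Φ₂[L] w) × ↥(archLocal L 2 Φ₂[L] w)), IsCompact 𝒮 ∧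
        ∀ z ∈ Zw' w, z.1 * (endoBlockAt L (insert w₀ S) w (c w) * z.2) * z.1⁻¹ ∈ C' → z ∈ 𝒮 := by
    intro w c hc C' hC'
    obtain ⟨𝒮, h𝒮, h⟩ := hprop' w {c} isCompact_singleton (fun hw c' hc' => by
      rw [Set.mem_singleton_iff.1 hc']; exact ((mem_regS_iff (insert w₀ S) c).1 hc).1 w hw) C' hC'
    exact ⟨𝒮, h𝒮, fun z hz hzC => h z hz c (Set.mem_singleton c) hzC⟩
  -- (3) transport of the leaf identities off `w₀` to the local data of `insert w₀ S` (one scalar per place)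
  have hκ : ∀ w : {w : InfinitePlace L // IsComplex w}, ∃ κ : ℝ≥0, κ ≠ 0 ∧ (w ≠ w₀ →
      ∀ (γ γ' : ↥(archLocal L 2 Φ₂[L] w)) (_ : γ = γ') (hγ : ∀ m ∈ chartTorusHLoc L S w, m * γ = γ * m)
        (hγ' : ∀ m ∈ chartTorusHLoc L (insert w₀ S) w, m * γ' = γ' * m),
        Measure.map (descConj γ' (chartTorusHLoc L (insert w₀ S) w) hγ' id)
            (quotientMeasure (chartTorusHLoc L (insert w₀ S) w) (chartHaarHLoc L (insert w₀ S) w) (isClosed_chartTorusHLoc L (insert w₀ S) w) (νw w)) =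
          κ • Measure.map (descConj γ (chartTorusHLoc L S w) hγ id)
            (quotientMeasure (chartTorusHLoc L S w) (chartHaarHLoc L S w) (isClosed_chartTorusHLoc L S w) (νw w))) := by
    intro w
    by_cases hw : w = w₀
    · exact ⟨1, one_ne_zero, fun h => absurd hw h⟩
    · obtain ⟨κ, hκ, h⟩ := exists_smul_map_descConj_quotientMeasure_of_eq (νw w) (chartTorusHLoc_eq_of_mem_iff L w (hmem w hw))
        (isClosed_chartTorusHLoc L S w) (isClosed_chartTorusHLoc L (insert w₀ S) w) (chartHaarHLoc L S w) (chartHaarHLoc L (insert w₀ S) w)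
      exact ⟨κ, hκ, fun _ => h⟩
  choose κ hκne hκ using hκ
  let Cw' : {w : InfinitePlace L // IsComplex w} → ℝ≥0 := fun w => if w = w₀ then C₀ else κ w * Cw w
  have hC'₀ : Cw' w₀ = C₀ := if_pos rfl
  have hleaf' : ∀ (w) (c : {w : InfinitePlace L // IsComplex w} → Fin 3 → ℝ), (w ∈ insert w₀ S → c w 0 ≠ 0) →
      Measure.map (descConj (endoBlockAt L (insert w₀ S) w (c w)) (chartTorusHLoc L (insert w₀ S) w) (forall_mem_chartTorusHLoc_comm L (insert w₀ S) w (c w)) id)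
          (quotientMeasure (chartTorusHLoc L (insert w₀ S) w) (chartHaarHLoc L (insert w₀ S) w) (isClosed_chartTorusHLoc L (insert w₀ S) w) (νw w)) =
        (Cw' w * (if w ∈ insert w₀ S then ‖(((Real.exp (-2 * c w 0) : ℝ) : ℂ)) - 1‖₊⁻¹ else 1)) •
          Measure.map (fun z : ↥(archLocal L 2 Φ₂[L] w) × ↥(archLocal L 2 Φ₂[L] w) => z.1 * (endoBlockAt L (insert w₀ S) w (c w) * z.2) * z.1⁻¹) (Λw' w) := by
    intro w c hcw
    by_cases hw : w = w₀
    · subst hw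
      rw [hC'₀, hΛ'₀]
      exact hleaf₀ c hcw
    · have hγ : endoBlockAt L S w = endoBlockAt L (insert w₀ S) w := endoBlockAt_eq_of_mem_iff L w (hmem w hw)
      have hS : w ∈ S → c w 0 ≠ 0 := fun h => hcw ((hmem w hw).1 h)
      have h1 := hκ w hw (endoBlockAt L S w (c w)) (endoBlockAt L (insert w₀ S) w (c w)) (congrFun hγ (c w))
        (forall_mem_chartTorusHLoc_comm L S w (c w)) (forall_mem_chartTorusHLoc_comm L (insert w₀ S) w (c w))
      have hCw : Cw' w = κ w * Cw w := if_neg hw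
      have hif : (if w ∈ insert w₀ S then ‖(((Real.exp (-2 * c w 0) : ℝ) : ℂ)) - 1‖₊⁻¹ else (1 : ℝ≥0)) =
          (if w ∈ S then ‖(((Real.exp (-2 * c w 0) : ℝ) : ℂ)) - 1‖₊⁻¹ else 1) := by
        by_cases h : w ∈ S
        · rw [if_pos h, if_pos ((hmem w hw).1 h)]
        · rw [if_neg h, if_neg (fun h' => h ((hmem w hw).2 h'))]
      rw [h1, hleaf w c hS, hCw, hif, hΛ'ne w hw, smul_smul, ← hγ, mul_assoc]
  -- (4) the unfolding identities (a) for both charts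
  have hCw'ne : ∀ w, Cw' w ≠ 0 := by
    intro w
    by_cases hw : w = w₀
    · subst hw; rw [hC'₀]; exact hC₀ne
    · have h : Cw' w = κ w * Cw w := if_neg hw
      rw [h]; exact mul_ne_zero (hκne w) (hCne w)
  obtain ⟨K₀, hK₀, hid⟩ := exists_pos_archRH_mul_chartOrbH_eq_of_placeLeaves_of_isHaarMeasure L S νw νH Λw Zw hZnull Cw hCne hprop1 hleaf
  obtain ⟨K₀', hK₀', hid'⟩ := exists_pos_archRH_mul_chartOrbH_eq_of_placeLeaves_of_isHaarMeasure L (insert w₀ S) νw νH Λw' Zw' hZnull' Cw' hCw'ne hprop1' hleaf'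
  -- (5) assemble the test-function-free part; then, per test function, smoothness (b), the model (c), the Fubini form (d) for each chart
  refine ⟨νw, hνw, hνr, K₀, K₀', Λw, Λw', Zw, Zw', C₀, hK₀, hK₀', hΛ'ne, hZ'ne, ⟨hΛfin, hσ, hZcl, hZnull, hexpl, hprop⟩, ⟨hΛ'fin, hσ', hZcl', hZnull', hexpl', hprop'⟩, hC₀ne,
    fun c hc0 => ?_, fun {fH} hfH => ?_⟩
  · have h := hleaf' w₀ c (fun _ => hc0)
    rw [hC'₀, if_pos hw₀'] at h
    exact h
  have hI : ContDiffOn ℝ ∞ (fun c : {w : InfinitePlace L // IsComplex w} → Fin 3 → ℝ =>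
      ∫ z, fH ((archPiEquivCM 2 L Φ₂[L]).symm (fun w => (z w).1 * (endoBlockAt L S w (c w) * (z w).2) * (z w).1⁻¹), (endoTorus L S c).2) ∂(Measure.pi Λw)) (InRegS S) :=
    contDiffOn_piLeafIntegral_inRegS L S hfH Λw Zw hZcl hZnull hprop
  have hI' : ContDiffOn ℝ ∞ (fun c : {w : InfinitePlace L // IsComplex w} → Fin 3 → ℝ =>
      ∫ z, fH ((archPiEquivCM 2 L Φ₂[L]).symm (fun w => (z w).1 * (endoBlockAt L (insert w₀ S) w (c w) * (z w).2) * (z w).1⁻¹), (endoTorus L (insert w₀ S) c).2)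
        ∂(Measure.pi Λw')) (InRegS (insert w₀ S)) :=
    contDiffOn_piLeafIntegral_inRegS L (insert w₀ S) hfH Λw' Zw' hZcl' hZnull' hprop'
  have hc := stOrbFamH_eq_model_of_regS_identity L S νH fH _ K₀ (hid fH hfH.continuous) hI
  have hc' := stOrbFamH_eq_model_of_regS_identity L (insert w₀ S) νH fH _ K₀' (hid' fH hfH.continuous) hI'
  have hd : ∀ (p : {w : InfinitePlace L // IsComplex w} → Prop) [DecidablePred p], (∀ w, p w → w ∉ S) →
      ∀ c : {w : InfinitePlace L // IsComplex w} → Fin 3 → ℝ, c ∈ InRegS S →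
        (∫ z, fH ((archPiEquivCM 2 L Φ₂[L]).symm (fun w => (z w).1 * (endoBlockAt L S w (c w) * (z w).2) * (z w).1⁻¹), (endoTorus L S c).2) ∂(Measure.pi Λw)) =
          ∫ z' : ∀ w : {w : {w : InfinitePlace L // IsComplex w} // ¬ p w}, ↥(archLocal L 2 Φ₂[L] w.1) × ↥(archLocal L 2 Φ₂[L] w.1),
            (∫ g : ∀ w : {w : {w : InfinitePlace L // IsComplex w} // p w}, ↥(archLocal L 2 Φ₂[L] w.1),
              fH ((archPiEquivCM 2 L Φ₂[L]).symm (fun w => if h : p w then g ⟨w, h⟩ * endoBlockAt L S w (c w) * (g ⟨w, h⟩)⁻¹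
                else (z' ⟨w, h⟩).1 * (endoBlockAt L S w (c w) * (z' ⟨w, h⟩).2) * (z' ⟨w, h⟩).1⁻¹), (endoTorus L S c).2)
              ∂(Measure.pi fun w : {w : {w : InfinitePlace L // IsComplex w} // p w} => νw w.1))
            ∂(Measure.pi fun w : {w : {w : InfinitePlace L // IsComplex w} // ¬ p w} => Λw w.1) := by
    intro p _ hp c hc
    have hreg : ∀ w, w ∉ S → Circle.exp (c w 0) ≠ Circle.exp (c w 2) := (mem_inRegS_iff S c).1 hc
    refine integral_unfoldIntegrand_eq_integral_integral L S fH hfH.continuous (ArchSmooth₂.hasCompactSupport L hfH) Λw Zw hZcl hZnull νw p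
      (fun w hw => hexpl w (hp w hw)) c (fun w C' hC' => ?_) (endoTorus L S c).2
    obtain ⟨𝒮, h𝒮, h⟩ := hprop w {c} isCompact_singleton (fun hw c' hc' => by rw [Set.mem_singleton_iff.1 hc']; exact hreg w hw) C' hC'
    exact ⟨𝒮, h𝒮, fun z hz hzC => h z hz c (Set.mem_singleton c) hzC⟩
  have hd' : ∀ (p : {w : InfinitePlace L // IsComplex w} → Prop) [DecidablePred p], (∀ w, p w → w ∉ insert w₀ S) →
      ∀ c : {w : InfinitePlace L // IsComplex w} → Fin 3 → ℝ, c ∈ InRegS (insert w₀ S) →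
        (∫ z, fH ((archPiEquivCM 2 L Φ₂[L]).symm (fun w => (z w).1 * (endoBlockAt L (insert w₀ S) w (c w) * (z w).2) * (z w).1⁻¹),
            (endoTorus L (insert w₀ S) c).2) ∂(Measure.pi Λw')) =
          ∫ z' : ∀ w : {w : {w : InfinitePlace L // IsComplex w} // ¬ p w}, ↥(archLocal L 2 Φ₂[L] w.1) × ↥(archLocal L 2 Φ₂[L] w.1),
            (∫ g : ∀ w : {w : {w : InfinitePlace L // IsComplex w} // p w}, ↥(archLocal L 2 Φ₂[L] w.1),
              fH ((archPiEquivCM 2 L Φ₂[L]).symm (fun w => if h : p w then g ⟨w, h⟩ * endoBlockAt L (insert w₀ S) w (c w) * (g ⟨w, h⟩)⁻¹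
                else (z' ⟨w, h⟩).1 * (endoBlockAt L (insert w₀ S) w (c w) * (z' ⟨w, h⟩).2) * (z' ⟨w, h⟩).1⁻¹), (endoTorus L (insert w₀ S) c).2)
              ∂(Measure.pi fun w : {w : {w : InfinitePlace L // IsComplex w} // p w} => νw w.1))
            ∂(Measure.pi fun w : {w : {w : InfinitePlace L // IsComplex w} // ¬ p w} => Λw' w.1) := by
    intro p _ hp c hc
    have hreg : ∀ w, w ∉ insert w₀ S → Circle.exp (c w 0) ≠ Circle.exp (c w 2) := (mem_inRegS_iff (insert w₀ S) c).1 hc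
    refine integral_unfoldIntegrand_eq_integral_integral L (insert w₀ S) fH hfH.continuous (ArchSmooth₂.hasCompactSupport L hfH) Λw' Zw' hZcl' hZnull' νw p
      (fun w hw => hexpl' w (hp w hw)) c (fun w C' hC' => ?_) (endoTorus L (insert w₀ S) c).2
    obtain ⟨𝒮, h𝒮, h⟩ := hprop' w {c} isCompact_singleton (fun hw c' hc' => by rw [Set.mem_singleton_iff.1 hc']; exact hreg w hw) C' hC'
    exact ⟨𝒮, h𝒮, fun z hz hzC => h z hz c (Set.mem_singleton c) hzC⟩
  -- (6) assemble the per-test-function clauses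
  exact ⟨⟨hid fH hfH.continuous, hI, hc, fun p _ hp c hcI => hd p hp c hcI⟩, ⟨hid' fH hfH.continuous, hI', hc', fun p _ hp c hcI => hd' p hp c hcI⟩⟩
end TwoChartsPos

end Literature.NumberTheory.Rogawski1990

end
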